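import Summits.MatrixMultiplication.OmegaCensus.StrongUSPOmegaBound
import Literature.Computability.AlgebraicComplexity.StrongUSPFamilies
import HarnessLib

/-!
# ω-census, family (b′) STPP / USP: CKSU's "Proposition 3.1 yields ω < 2.67 with m = 9" as a theorem

HONEST FRAMING (pub-omega census; verbatim): lottery ticket; floor = certified bounds/negative ranges.
Census BOOKKEEPING for the Cohn–Umans STPP / USP track, not progress on `ω` (the tree proves `ω < 2.373` by the
laser method).  This file re-derives, END-TO-END IN THE KERNEL, the first printed ω-bound of the strong-USP method:
Cohn–Kleinberg–Szegedy–Umans 2005, §3.3: "Proposition 3.1 yields `ω < 2.67` with `m = 9`" (census control row R27,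
value `2.6699250014`, previously certified ×3 by engines only).

Chain (all tree theorems, 0 facts): `isStrongUSP_cksuStrongUSP k` (CKSU Prop. 3.1 / 11: the explicit strong USP of
`2^k` rows and width `2k`, `Literature/…/StrongUSPFamilies.lean`) → `omega_le_of_isStrongUSP` (CKSU Cor. 3.6 / 16 via
Prop. 6.3 / 34 and Thm. 5.5, `StrongUSPOmegaBound.lean`) → `log (2^k)! ≥ 2^k (k log 2 − 1)` (from `xⁿ/n! ≤ eˣ`) →
for every `k ≥ 1`, `ω ≤ 3 (log m − (log 2)/2 + 1/(2k)) / log(m − 1)` (`omega_le_of_cksuStrongUSP`) → letting `k → ∞`,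
`ω ≤ 3 (log m − (log 2)/2) / log(m − 1)` (`omega_le_cksu_prop11_limit`; at `m = 9` this is `3 log(9/√2)/log 8 =
2.66992500144…`) → `ω ≤ 2.67` (`omega_le_of_cksuProp11_m9`, decimal certificate `3^600 ≤ 2^951`).

## References
* H. Cohn, R. Kleinberg, B. Szegedy, C. Umans, *Group-theoretic algorithms for matrix multiplication*, FOCS 2005;
  arXiv:math/0511460, §3: Proposition 11, Corollary 16 and the sentence after it (p. 6). [CohnKleinbergSzegedyUmans2005]
-/

noncomputable section

namespace Summit.MatrixMultiplication.OmegaCensus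

open Literature.Computability.AlgebraicComplexity

/-- Stirling from below, the only analysis needed: `s log s − s ≤ log s!` (from `s^s / s! ≤ e^s`,
`Real.pow_div_factorial_le_exp`). [folklore] -/
private theorem mul_log_sub_le_log_factorial (s : ℕ) :
    (s : ℝ) * Real.log s - s ≤ Real.log (Nat.factorial s : ℕ) := by
  have hf : (0 : ℝ) < (Nat.factorial s : ℕ) := by exact_mod_cast Nat.factorial_pos s
  have h := Real.pow_div_factorial_le_exp (s : ℝ) (Nat.cast_nonneg s) s
  rw [div_le_iff₀ hf] at h
  rcases Nat.eq_zero_or_pos s with hs | hs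
  · subst hs; simp
  have hpos : (0 : ℝ) < (s : ℝ) ^ s := by positivity
  have hlog := Real.log_le_log hpos h
  rw [Real.log_pow, Real.log_mul (Real.exp_pos _).ne' hf.ne', Real.log_exp] at hlog
  linarith

/-- **CKSU Proposition 3.1 / 11 fed to Corollary 3.6 / 16, finite `k`**: for every `k ≥ 1` and `m ≥ 3`,
`ω ≤ 3 (log m − (log 2)/2 + 1/(2k)) / log (m − 1)` — from `omega_le_of_isStrongUSP` for the strong USP
`cksuStrongUSP k` (`2^k` rows, width `2k`) and `log (2^k)! ≥ 2^k (k log 2 − 1)`.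
[cite: CohnKleinbergSzegedyUmans2005, Proposition 11 and Corollary 16 (§3)] -/
theorem omega_le_of_cksuStrongUSP (k : ℕ) (hk : 1 ≤ k) {m : ℕ} (hm : 3 ≤ m) :
    omega ℂ ≤ 3 * (Real.log m - Real.log 2 / 2 + 1 / (2 * k)) / Real.log ((m : ℝ) - 1) := by
  have h0 := omega_le_of_isStrongUSP (isStrongUSP_cksuStrongUSP k) (Nat.two_pow_pos k)
    (by omega : 0 < k + k) hm
  -- abbreviations
  set S : ℝ := ((2 ^ k : ℕ) : ℝ) with hSdef
  have hS : S = (2 : ℝ) ^ k := by rw [hSdef]; push_cast; ring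
  have hSpos : 0 < S := by rw [hS]; positivity
  have hkpos : (0 : ℝ) < k := by exact_mod_cast hk
  have hL : 0 < Real.log ((m : ℝ) - 1) := by
    apply Real.log_pos
    have : (3 : ℝ) ≤ m := by exact_mod_cast hm
    linarith
  have hN : (((2 ^ k * (k + k) : ℕ) : ℝ)) = S * (2 * k) := by rw [hSdef]; push_cast; ring
  rw [hN] at h0
  have hNpos : 0 < S * (2 * k) := by positivity
  -- log S! ≥ S log S − S = S (k log 2) − S
  have hfact := mul_log_sub_le_log_factorial (2 ^ k)
  have hlogS : Real.log ((2 ^ k : ℕ) : ℝ) = k * Real.log 2 := by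
    push_cast; rw [Real.log_pow]
  rw [hlogS] at hfact
  -- compare the two right-hand sides
  refine h0.trans ?_
  rw [div_le_div_iff₀ (by positivity) hL]
  -- 3 * (S*(2k) * log m − log S!) * L ≤ 3 * (log m − log 2 / 2 + 1/(2k)) * (S*(2k) * L)
  have hkey : S * (2 * k) * Real.log m - Real.log ((Nat.factorial (2 ^ k) : ℕ) : ℝ) ≤
      (Real.log m - Real.log 2 / 2 + 1 / (2 * k)) * (S * (2 * k)) := by
    have e : (Real.log m - Real.log 2 / 2 + 1 / (2 * k)) * (S * (2 * k)) =
        S * (2 * k) * Real.log m - (S * k * Real.log 2 - S) := by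
      field_simp; ring
    rw [e]
    have : ((2 ^ k : ℕ) : ℝ) * (k * Real.log 2) - ((2 ^ k : ℕ) : ℝ) = S * k * Real.log 2 - S := by
      rw [hSdef]; ring
    linarith
  nlinarith [hkey, hL]

/-- **CKSU: "Proposition 3.1 yields `ω < 2.67` with `m = 9`" — the limit `k → ∞` as a closed form**: for every
`m ≥ 3`, `ω ≤ 3 (log m − (log 2)/2) / log (m − 1)` (at `m = 9`: `3 log(9/√2)/log 8 = 2.66992500…`, the value
of census control row R27).  Proof: `omega_le_of_cksuStrongUSP` for every `k ≥ 1` and `1/(2k) → 0`.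
[cite: CohnKleinbergSzegedyUmans2005, §3.3 after Corollary 16 (p. 6): "Proposition 3.1 yields ω < 2.67 with m = 9"] -/
theorem omega_le_cksu_prop11_limit {m : ℕ} (hm : 3 ≤ m) :
    omega ℂ ≤ 3 * (Real.log m - Real.log 2 / 2) / Real.log ((m : ℝ) - 1) := by
  have hL : 0 < Real.log ((m : ℝ) - 1) := by
    apply Real.log_pos
    have : (3 : ℝ) ≤ m := by exact_mod_cast hm
    linarith
  apply le_of_forall_pos_lt_add
  intro ε hε
  -- choose k with 3/(2k log(m−1)) < ε
  obtain ⟨k, hk⟩ := exists_nat_gt (3 / (2 * ε * Real.log ((m : ℝ) - 1)))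
  have hkpos : (0 : ℝ) < k := lt_of_le_of_lt (by positivity) hk
  have hk1 : 1 ≤ k := by exact_mod_cast hkpos
  have h := omega_le_of_cksuStrongUSP k hk1 hm
  have hsplit : 3 * (Real.log m - Real.log 2 / 2 + 1 / (2 * k)) / Real.log ((m : ℝ) - 1) =
      3 * (Real.log m - Real.log 2 / 2) / Real.log ((m : ℝ) - 1) + 3 / (2 * k * Real.log ((m : ℝ) - 1)) := by
    field_simp
  rw [hsplit] at h
  have hsmall : 3 / (2 * k * Real.log ((m : ℝ) - 1)) < ε := by
    rw [div_lt_iff₀ (by positivity)]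
    rw [div_lt_iff₀ (by positivity)] at hk
    nlinarith [hk, hL, hε]
  linarith

/-- Census control row R27 at KERNEL grade: **`ω ≤ 2.67` by the group-theoretic method from CKSU's strong USP
family of Proposition 3.1 / 11 with `m = 9`** (printed: "Proposition 3.1 yields ω < 2.67 with m = 9"; exact limit
value `3 log(9/√2)/log 8 = 2.6699250014…`; decimal certificate `3^600 ≤ 2^951`, i.e. `600 log 3 ≤ 951 log 2`).
Not a competitive bound (the tree has `ω < 2.373`); it is the printed CKSU example re-derived end-to-end as a theorem.
[cite: CohnKleinbergSzegedyUmans2005, §3.3 (p. 6), Proposition 11 + Corollary 16] -/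
theorem omega_le_of_cksuProp11_m9 : omega ℂ ≤ 2.67 := by
  have h := omega_le_cksu_prop11_limit (m := 9) (by norm_num)
  have h9 : Real.log ((9 : ℕ) : ℝ) = 2 * Real.log 3 := by
    rw [show ((9 : ℕ) : ℝ) = (3 : ℝ) ^ 2 by norm_num, Real.log_pow]; push_cast; ring
  have h8 : Real.log (((9 : ℕ) : ℝ) - 1) = 3 * Real.log 2 := by
    rw [show ((9 : ℕ) : ℝ) - 1 = (2 : ℝ) ^ 3 by norm_num, Real.log_pow]; push_cast; ring
  rw [h9, h8] at h
  have hlog2 : 0 < Real.log 2 := Real.log_pos (by norm_num)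
  -- 600 log 3 ≤ 951 log 2 from 3^600 ≤ 2^951
  have hpow : (3 : ℝ) ^ 600 ≤ (2 : ℝ) ^ 951 := by
    have : (3 ^ 600 : ℕ) ≤ 2 ^ 951 := by decide +kernel
    exact_mod_cast this
  have hlogs : 600 * Real.log 3 ≤ 951 * Real.log 2 := by
    have := Real.log_le_log (by positivity) hpow
    rwa [Real.log_pow, Real.log_pow] at this
  refine h.trans ?_
  rw [div_le_iff₀ (by positivity)]
  nlinarith [hlogs, hlog2]

end Summit.MatrixMultiplication.OmegaCensus

end
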